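import Mathlib.Analysis.InnerProductSpace.PiL2
import Literature.MathematicalPhysics.QuantumFieldTheory.Balaban1983to89.NodeOTorusBlocks

/-!
# `Balaban1983to89.NodeOFlatTransfer` — T. Bałaban, *Propagators for lattice gauge theories in a background field*, CMP **99** (1985) 389–434
# [Balaban1985BackgroundPropagators] (3.15) p. 393 and (3.4) p. 391 AT `U = 1`, with [Balaban1984PropagatorsII] (2.125) p. 245 and [Balaban1985Averaging] (125)
# p. 36: **THE FLAT ONE-STEP AVERAGING IS THE PRINTED `Q₁` OF (2.125) WITH `λ_{d,L} = 1`; THE FLAT COVARIANT CURL IS `η⁻¹·curlSum`; AND THE FIBRE-TO-SCALAR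
# TRANSFER OF (2.128)-SHAPED QUADRATIC INEQUALITIES** (steps D1–D4 of the flat axial coercivity, completed in module 4 `NodeOFlatAxial`)

statement-level skeleton of published theorems with citation tags; proofs where landed; nothing here is a claim about the Yang–Mills mass gap

CITATION HEADER (lean-in-tree rule).  Ideation cell `ym-nodeO-ideate` (portfolio track, 2026-08-25), seat P1 «inside Bałaban», memo
`memos/ROUTE-P1.md` v3.17 (sha256 d4d6d9a6…) §0q (FINDINGS F10∕F11) and §0p (F9).  LANDING EDITION (generation 12, F-series module 3∕5) of the memo
companion `memos/ROUTE-P1-SketchFlatQ.lean` («companion 7», sha256 a5130964…, 416 l., 0 `sorry`; farm rc 0, axioms standard) §1–§4 (lines 47–265,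
its §Sums replaced by module 1's identical `curlSum`∕`qSum`); referee track = the cell's `STATUS.md` (REF∕LIT verdict lines on v3.17 and on this edition are the filing precondition; the courier files
REF-named editions only, unchanged; director-ym LINE №2 (B), operator 2026-08-25T18:24:34Z).  Statements and proofs below are CHARACTER-IDENTICAL to the
companion's; edition deltas = the namespace (`YMNodeOIdeate.P1.FlatQ` → this module's), this header, the import of module 1 `NodeOTorusBlocks` with `open NodeOTorusBlocks (curlSum qSum)` replacing the companion's verbatim-identical `section Sums`, the companion's `open …Balaban1983to89` line dropped
(the opens now resolve inside the tree namespace), bare `Plaq`∕`block` spelled `B9SectCLatticeCarrier.Plaq`∕`B6Elimination.block` in code (inside the tree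
namespace the topic root's `Setup.lean` `Plaq`∕`block` shadow the opens),
for the gate lint `literature-cited-only` (LIT pre-flight 2026-08-25T20:35:30Z: `[folklore]` alone only on private helpers) 2 same-module helper(s) marked `private`
(`norm_sq_eq_sum_re_sq_add_im_sq`, `norm_sq_linform`) and 2 cross-module helper(s) given a serving cite tag next to `[folklore]` (`quadIneq_transfer`, `quadIneq_transfer₂`), and nothing else.  EACH `[cite:]` TAG NAMES THE PRINTED DISPLAY THE DECLARATION SERVES OR TRANSCRIBES —
the proofs are finite-sum bookkeeping ∕ linear algebra of ours; print proves none of them as stated.  Sources READ (renders, LIT `lit/SOURCES.md` v2.75):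
[Balaban1985BackgroundPropagators] pp. 391, 393, 396; [Balaban1984PropagatorsII] = CMP **96** p. 245; [Balaban1985Averaging] p. 36.

PRINT STATUS.  That the one-step averaging at `U = 1` is the straight block average (2.125) is print ([Balaban1984PropagatorsI] (1.7)–(1.9), [Balaban1985Averaging]
(125) with trivial transports); the tree DEFINES `B9Eq315QTorus.QtorusW` by [Balaban1985BackgroundPropagators] (3.15) and §1–§2 below UNFOLD it at `U = 1`
(normalisation `λ_{d,L} = 1` — a check print never displays).  The fibre transfer §4 (a real-coefficient quadratic inequality valid for all real families vanishing
on `Z` holds for `W`-valued ones, `W` a finite-dimensional complex inner-product space) is the unstated remark behind applying the scalar Lemma 2.4 to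
`𝔤`-valued fields; elementary (orthonormal coordinates), not in print.

WHAT IS PROVED (sorry-free; standard axioms).  §1 `QtorusLin_one_apply`; §2 **`equiv_QtorusW_one`** (D3: `(Q(1)f)(y,κ) = Σ_r (L^{d+1})⁻¹ • Σ_{i<L} f(⟨L·y + r + i·e_κ⟩, κ)`),
`equiv_QtorusW_one_eq_smul_qSum`, **`equiv_covCurlL2K_one`** (D2), **`hflat_of_RW`** (D1: the weighted-`L²` flat axial coercivity `hflat` from the explicit-sum
inequality `RW` for `W`-valued fields, by `WL2.norm_sq`); §4 `norm_sq_eq_sum_re_sq_add_im_sq`, `quadIneq_transfer`, `norm_sq_linform`, **`quadIneq_transfer₂`** (D4).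

WHAT THIS IS NOT.  Not NODE O (`B13TermWalkDataOneTorus.ExistsUniformAcrossSmall`, :353), not [Balaban1987RG1] Thm 2 + (0.31) p. 259, not the `γ₀`
sentence of [Balaban1985BackgroundPropagators] p. 428 (whose road is `NodeOGamma0Road.hcoer_of_letters` MODULO its letters), not a new estimate: the real inequality itself (`Rreal` ⟸ torus (2.128)) and the constant are module 4; the torus (2.128) is module 2.
-/

noncomputable section

open scoped BigOperators InnerProductSpace

namespace Literature.MathematicalPhysics.QuantumFieldTheory.Balaban1983to89.NodeOFlatTransfer

open B4Sect5Torus (TSite)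
open B9SectCLatticeCarrier (Bond Plaq shift bpos)
open B7Prop1Explicit (e boxVec seg asum asum_seg_natCast U1 Wcx)
open B7Prop3Flat (linQ)
open B7Prop3GeneralLinear (linQcov linQcov_one_left)
open B9Eq311L2Pairing (WL2)
open B11Eq103H1Complex (BondL2K)
open B9Eq310HessianOperator (PlaqL2K covCurlL2K equiv_covCurlL2K adTransportW)
open B9Eq34CovCurlVector (covCurl covCurl_apply_coord)
open B9Eq319QprimeTorus (fineP blockCoord)
open B9Eq315QTorusOnto (liftSite)
open B9Eq315QTorus (perSite perCfg perCfg_apply cornerSite QtorusLin QtorusLin_apply QtorusW QtorusW_apply)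
open B5Eq155FlatAveragingCommute (perCfg_one norm_perCfg_le adTransportW_flat)
open NodeOTorusBlocks (curlSum qSum)

variable {d : ℕ}
variable {𝔸 : Type*} [NormedRing 𝔸] [NormedAlgebra ℂ 𝔸] [CompleteSpace 𝔸] [NormOneClass 𝔸]
  (L : ℕ) [NeZero L] (m : Fin d → ℕ) [∀ i, NeZero (fineP L m i)] (hL : 1 ≤ L)
  {W : Type*} [NormedAddCommGroup W] [InnerProductSpace ℂ W] (φ : W ≃ₗ[ℂ] 𝔸) {c₀ c₁ : ℝ} [Fact (0 < c₀)] [Fact (0 < c₁)]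
  {α : ℝ} (hα1 : α ≤ 1 / 64)
  (hU1 : ∀ (x : B7Prop1Explicit.Site d) (κ : Fin d), perCfg (fineP L m) (fun _ : Bond d (fineP L m) => (1 : 𝔸ˣ)) x κ ∈ U1 𝔸)
  (hreg : ∀ (y : TSite d m) (κ : Fin d) (r : Fin d → Fin L),
    ‖((Wcx L (perCfg (fineP L m) (fun _ : Bond d (fineP L m) => (1 : 𝔸ˣ))) (cornerSite L y) κ (boxVec L r) : 𝔸ˣ) : 𝔸) - 1‖ ≤ α)

omit [NeZero L] [Fact (0 < c₀)] [Fact (0 < c₁)] in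
/-- **§1 (algebra level).** At `U = 1` the torus `Q(U)` of [B9] (3.15) is the straight-line block average:
`(Q(1)A)(y, κ) = L⁻¹ · Σ_{r∈[0,L)^d} L^{−d} · Σ_{i<L} A(⟨L·y + r + i·e_κ⟩_per, κ)` (the frame terms of [B7] (124) vanish at
`V₀ = 1`: `linQcov_one_left`; the segment sum is `asum_seg_natCast`).
[cite: Balaban1985Averaging, (125) p.36; Balaban1984PropagatorsII, (2.125) p.245] -/
theorem QtorusLin_one_apply (A : Bond d (fineP L m) → 𝔸) (y : TSite d m) (κ : Fin d) :
    QtorusLin L m hL (fun _ => 1) hα1 hU1 hreg A (y, κ) =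
      ((L : ℂ))⁻¹ • ∑ r : Fin d → Fin L, (((L : ℝ) ^ d)⁻¹) •
        ∑ i ∈ Finset.range L, A (perSite (fineP L m) (cornerSite L y + boxVec L r + (i : ℤ) • e κ), κ) := by
  rw [QtorusLin_apply, perCfg_one,
    linQcov_one_left L hL _ (Finset.sum_nonneg fun b _ => norm_nonneg _) (norm_perCfg_le _), linQ]
  simp only [asum_seg_natCast, perCfg_apply]

omit [NeZero L] [Fact (0 < c₀)] [Fact (0 < c₁)] in
/-- **§2 (Hilbert-fibre level) — D3, verbatim (2.125) normalisation.** For `f` in the fine weighted `L²` space and a coarse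
bond `(y, κ)`: `(Q(1)f)(y, κ) = Σ_{r∈[0,L)^d} L^{−(d+1)} · Σ_{i<L} f(⟨L·y + r + i·e_κ⟩_per, κ)` — the printed
«(Q₁B)(c) = Σ_{x∈B(c₋)} L^{−(d+1)} B([x, x + Le_μ])» with `B(c₋) = L·y + [0,L)^d`; so the `aQ*Q` letter of [B9] (3.26) at
`U = 1` is `a·c₁·Σ_c ‖(Q₁f)(c)‖²` with NO extra constant (`λ_{d,L} = 1` in memo §0p.3).
[cite: Balaban1984PropagatorsII, (2.125) p.245; Balaban1985Averaging, (125) p.36; Balaban1985BackgroundPropagators, (3.15) p.393] -/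
theorem equiv_QtorusW_one (f : BondL2K ℂ d (fineP L m) c₀ W) (y : TSite d m) (κ : Fin d) :
    WL2.equiv ℂ _ W (QtorusW L m hL φ (fun _ => 1) hα1 hU1 hreg (c₁ := c₁) f) (y, κ) =
      ∑ r : Fin d → Fin L, (((L : ℂ)) ^ (d + 1))⁻¹ •
        ∑ i ∈ Finset.range L, WL2.equiv ℂ _ W f (perSite (fineP L m) (cornerSite L y + boxVec L r + (i : ℤ) • e κ), κ) := by
  rw [QtorusW_apply, QtorusLin_one_apply, LinearEquiv.symm_apply_eq]
  simp only [map_smul, map_sum, ← Complex.coe_smul, Finset.smul_sum, smul_smul]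
  refine Finset.sum_congr rfl fun r _ => Finset.sum_congr rfl fun i _ => ?_
  congr 1
  push_cast
  ring

/-! ## §3  The three norms of the `hflat` binder as EXPLICIT FINITE SUMS (D1 + D2 + D3), and the reduction of `hflat`
(= J1a as typed in companion 6 `LocAxialRoad.hloc_axial_of_flat₀`) to an explicit-sum inequality `RW` for `W`-valued
bond functions, then (§4–§5) to the same inequality `Rreal` for REAL bond functions (D4). -/


omit [NeZero L] [Fact (0 < c₀)] [Fact (0 < c₁)] in
/-- D3 packaged: `(Q(1)f)(c) = L^{−(d+1)} • qSum f c`. [cite: Balaban1984PropagatorsII, (2.125) p.245] -/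
theorem equiv_QtorusW_one_eq_smul_qSum (f : BondL2K ℂ d (fineP L m) c₀ W) (c : Bond d m) :
    WL2.equiv ℂ _ W (QtorusW L m hL φ (fun _ => 1) hα1 hU1 hreg (c₁ := c₁) f) c =
      (((L : ℂ)) ^ (d + 1))⁻¹ • qSum L m (WL2.equiv ℂ _ W f) c := by
  obtain ⟨y, κ⟩ := c
  rw [equiv_QtorusW_one, qSum, Finset.smul_sum]

omit [CompleteSpace 𝔸] [NormOneClass 𝔸] [NeZero L] [∀ i, NeZero (fineP L m i)] [Fact (0 < c₁)] in
/-- D2 packaged: at `U = 1` the value of the tree's curl (3.4) at a plaquette is `η⁻¹ • curlSum`. [cite: Balaban1985BackgroundPropagators, (3.4) p.391] -/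
theorem equiv_covCurlL2K_one (η : ℝ) (A : BondL2K ℂ d (fineP L m) c₀ W) (p : B9SectCLatticeCarrier.Plaq d (fineP L m)) :
    WL2.equiv ℂ _ W (covCurlL2K ℂ c₀ ((η : ℂ))⁻¹ (adTransportW φ fun _ : Bond d (fineP L m) => (1 : 𝔸ˣ)) A) p =
      ((η : ℂ))⁻¹ • curlSum (WL2.equiv ℂ _ W A) p := by
  obtain ⟨x, q⟩ := p
  rw [equiv_covCurlL2K, covCurl_apply_coord, adTransportW_flat, adTransportW_flat, LinearMap.id_apply, LinearMap.id_apply]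
  simp only [curlSum, smul_sub]

omit [NeZero L] in
/-- **`hflat` ⟸ `RW`.**  The `hflat` binder of companion 6 (`hloc_axial_of_flat₀`, verbatim) follows from the explicit-sum
inequality for `W`-valued bond functions
`RW`: `γ_f·c₀·Σ_b ‖F_b‖² ≤ c₀·η⁻²·Σ_p ‖curlSum F p‖² + a·c₁·L^{−2(d+1)}·Σ_c ‖qSum F c‖²` for every `F` vanishing on `T` and
on the bonds starting outside the blocks of `Y` (D1 `WL2.norm_sq`, D2 `equiv_covCurlL2K_one`, D3 `equiv_QtorusW_one_eq_smul_qSum`).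
[cite: Balaban1984PropagatorsII, Lemma 2.4 (2.128) p.245; Balaban1985BackgroundPropagators, (3.4) p.391, (3.15) p.393] -/
theorem hflat_of_RW (η : ℝ) {ρ : ℕ} (T : Set (Bond d (fineP L m))) {a γf : ℝ} (ha : 0 ≤ a)
    (hRW : ∀ (y₁ : TSite d m) (Y : Set (TSite d m)),
      (∀ y ∈ Y, ∀ i, 1 ≤ liftSite (y - y₁) i ∧ liftSite (y - y₁) i ≤ ((2 * ρ : ℕ) : ℤ) + 1) →
      ∀ F : Bond d (fineP L m) → W, (∀ b ∈ T, F b = 0) → (∀ b, blockCoord L m (bpos b) ∉ Y → F b = 0) →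
        γf * (c₀ * ∑ b, ‖F b‖ ^ 2) ≤
          c₀ * η⁻¹ ^ 2 * ∑ p, ‖curlSum F p‖ ^ 2 + a * c₁ * ((L : ℝ) ^ (d + 1))⁻¹ ^ 2 * ∑ c, ‖qSum L m F c‖ ^ 2) :
    ∀ (y₁ : TSite d m) (Y : Set (TSite d m)),
      (∀ y ∈ Y, ∀ i, 1 ≤ liftSite (y - y₁) i ∧ liftSite (y - y₁) i ≤ ((2 * ρ : ℕ) : ℤ) + 1) →
      ∀ A' : BondL2K ℂ d (fineP L m) c₀ W, (∀ b ∈ T, WL2.equiv ℂ _ W A' b = 0) →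
        (∀ b : Bond d (fineP L m), blockCoord L m (bpos b) ∉ Y → WL2.equiv ℂ _ W A' b = 0) →
        γf * ‖A'‖ ^ 2 ≤ ‖covCurlL2K ℂ c₀ ((η : ℂ))⁻¹ (adTransportW φ fun _ : Bond d (fineP L m) => (1 : 𝔸ˣ)) A'‖ ^ 2 +
          ‖((Real.sqrt a : ℝ) : ℂ) • QtorusW L m hL φ (fun _ : Bond d (fineP L m) => (1 : 𝔸ˣ)) hα1 hU1 hreg (c₁ := c₁) A'‖ ^ 2 := by
  intro y₁ Y hY A' hT hY0
  have h := hRW y₁ Y hY (WL2.equiv ℂ _ W A') hT hY0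
  have h1 : ‖A'‖ ^ 2 = c₀ * ∑ b, ‖WL2.equiv ℂ _ W A' b‖ ^ 2 := by
    rw [WL2.norm_sq (𝕜 := ℂ) (w := fun _ : Bond d (fineP L m) => c₀) (V := W), ← Finset.mul_sum]
  have h2 : ‖covCurlL2K ℂ c₀ ((η : ℂ))⁻¹ (adTransportW φ fun _ : Bond d (fineP L m) => (1 : 𝔸ˣ)) A'‖ ^ 2 =
      c₀ * η⁻¹ ^ 2 * ∑ p, ‖curlSum (WL2.equiv ℂ _ W A') p‖ ^ 2 := by
    rw [WL2.norm_sq (𝕜 := ℂ) (w := fun _ : B9SectCLatticeCarrier.Plaq d (fineP L m) => c₀) (V := W), Finset.mul_sum]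
    refine Finset.sum_congr rfl fun p _ => ?_
    rw [equiv_covCurlL2K_one, norm_smul, mul_pow, norm_inv, Complex.norm_real, Real.norm_eq_abs, inv_pow, sq_abs]
    ring
  have h3 : ‖((Real.sqrt a : ℝ) : ℂ) • QtorusW L m hL φ (fun _ : Bond d (fineP L m) => (1 : 𝔸ˣ)) hα1 hU1 hreg (c₁ := c₁) A'‖ ^ 2 =
      a * c₁ * ((L : ℝ) ^ (d + 1))⁻¹ ^ 2 * ∑ c, ‖qSum L m (WL2.equiv ℂ _ W A') c‖ ^ 2 := by
    rw [norm_smul, mul_pow, Complex.norm_real, Real.norm_eq_abs, sq_abs, Real.sq_sqrt ha,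
      WL2.norm_sq (𝕜 := ℂ) (w := fun _ : Bond d m => c₁) (V := W), Finset.mul_sum, Finset.mul_sum]
    refine Finset.sum_congr rfl fun c _ => ?_
    rw [equiv_QtorusW_one_eq_smul_qSum, norm_smul, mul_pow, norm_inv, norm_pow, Complex.norm_natCast]
    ring
  rw [h1, h2, h3]
  exact h

/-! ## §4  D4 — FIBRE TRANSFER: a real-coefficient quadratic inequality that holds for every REAL bond function vanishing
on a set `Z` holds, with the SAME constant, for every `W`-valued one (`W` a finite-dimensional complex inner-product
fibre).  Shape chosen to cover [B6] Lemma 2.4′ (`B6Lemma24Kappa.lemma24_printedShape18_kappa1`: LHS `κ·Σ_{b∈E} B_b²`,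
RHS a weighted sum of squares of finitely supported real linear forms `B ↦ Σ_{p∈S_t} c_{t,p}·B(g_t p)` — the `Q₁`
double sums (2.125) and the plaquette curls — hypotheses `B = 0` on a set: off `Λ`, and on the tree contours (2.121)). -/

section Transfer

variable {ι τ π : Type*} {V : Type*} [NormedAddCommGroup V] [InnerProductSpace ℂ V]

/-- Coordinates: for an orthonormal basis `e` of `V`, `‖w‖² = Σ_j ((re⟪e_j, w⟫)² + (im⟪e_j, w⟫)²)`. [folklore] -/
private theorem norm_sq_eq_sum_re_sq_add_im_sq {n : Type*} [Fintype n] (e : OrthonormalBasis n ℂ V) (w : V) :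
    ‖w‖ ^ 2 = ∑ j, ((⟪e j, w⟫_ℂ).re ^ 2 + (⟪e j, w⟫_ℂ).im ^ 2) := by
  rw [← e.repr.norm_map w, EuclideanSpace.norm_sq_eq]
  refine Finset.sum_congr rfl fun j _ => ?_
  rw [e.repr_apply_apply, Complex.sq_norm, Complex.normSq_apply]
  ring

variable [FiniteDimensional ℂ V]

/-- **D4 (fibre transfer).** If `κ·Σ_{b∈E} B_b² ≤ Σ_{t∈Tm} w_t·(Σ_{p∈S_t} c_{t,p}·B(g_t p))²` for every real `B` vanishing on
`Z`, then `κ·Σ_{b∈E} ‖F_b‖² ≤ Σ_{t∈Tm} w_t·‖Σ_{p∈S_t} c_{t,p}•F(g_t p)‖²` for every `V`-valued `F` vanishing on `Z`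
(apply the real inequality to the `2·dim V` real coordinates `re⟪e_j, F·⟫`, `im⟪e_j, F·⟫` and sum; the linear forms have
REAL coefficients, so they commute with taking coordinates). [cite: Balaban1984PropagatorsII, Lemma 2.4 (2.128) p.245] [folklore] -/
theorem quadIneq_transfer (E : Finset ι) (Z : Set ι) (κ : ℝ) (Tm : Finset τ) (w : τ → ℝ)
    (S : τ → Finset π) (coef : τ → π → ℝ) (g : τ → π → ι)
    (hreal : ∀ B : ι → ℝ, (∀ b ∈ Z, B b = 0) →
      κ * ∑ b ∈ E, B b ^ 2 ≤ ∑ t ∈ Tm, w t * (∑ p ∈ S t, coef t p * B (g t p)) ^ 2)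
    (F : ι → V) (hF : ∀ b ∈ Z, F b = 0) :
    κ * ∑ b ∈ E, ‖F b‖ ^ 2 ≤ ∑ t ∈ Tm, w t * ‖∑ p ∈ S t, ((coef t p : ℝ) : ℂ) • F (g t p)‖ ^ 2 := by
  classical
  set e := stdOrthonormalBasis ℂ V
  have hre : ∀ j, κ * ∑ b ∈ E, (⟪e j, F b⟫_ℂ).re ^ 2 ≤
      ∑ t ∈ Tm, w t * (∑ p ∈ S t, coef t p * (⟪e j, F (g t p)⟫_ℂ).re) ^ 2 :=
    fun j => hreal (fun b => (⟪e j, F b⟫_ℂ).re) (fun b hb => by simp [hF b hb])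
  have him : ∀ j, κ * ∑ b ∈ E, (⟪e j, F b⟫_ℂ).im ^ 2 ≤
      ∑ t ∈ Tm, w t * (∑ p ∈ S t, coef t p * (⟪e j, F (g t p)⟫_ℂ).im) ^ 2 :=
    fun j => hreal (fun b => (⟪e j, F b⟫_ℂ).im) (fun b hb => by simp [hF b hb])
  have hV : ∀ j t, ⟪e j, ∑ p ∈ S t, ((coef t p : ℝ) : ℂ) • F (g t p)⟫_ℂ =
      ∑ p ∈ S t, ((coef t p : ℝ) : ℂ) * ⟪e j, F (g t p)⟫_ℂ := by
    intro j t
    rw [inner_sum]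
    exact Finset.sum_congr rfl fun p _ => inner_smul_right _ _ _
  calc κ * ∑ b ∈ E, ‖F b‖ ^ 2
      = ∑ j, (κ * ∑ b ∈ E, (⟪e j, F b⟫_ℂ).re ^ 2 + κ * ∑ b ∈ E, (⟪e j, F b⟫_ℂ).im ^ 2) := by
        simp_rw [norm_sq_eq_sum_re_sq_add_im_sq e]
        rw [Finset.sum_comm, Finset.mul_sum]
        simp only [Finset.sum_add_distrib, mul_add]
    _ ≤ ∑ j, ∑ t ∈ Tm, w t * ((∑ p ∈ S t, coef t p * (⟪e j, F (g t p)⟫_ℂ).re) ^ 2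
            + (∑ p ∈ S t, coef t p * (⟪e j, F (g t p)⟫_ℂ).im) ^ 2) :=
        Finset.sum_le_sum fun j _ =>
          (add_le_add (hre j) (him j)).trans_eq (by rw [← Finset.sum_add_distrib]; simp only [mul_add])
    _ = ∑ t ∈ Tm, w t * ‖∑ p ∈ S t, ((coef t p : ℝ) : ℂ) • F (g t p)‖ ^ 2 := by
        rw [Finset.sum_comm]
        refine Finset.sum_congr rfl fun t _ => ?_
        rw [norm_sq_eq_sum_re_sq_add_im_sq e, Finset.mul_sum]
        refine Finset.sum_congr rfl fun j _ => ?_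
        rw [hV, Complex.re_sum, Complex.im_sum]
        simp only [Complex.re_ofReal_mul, Complex.im_ofReal_mul]

omit [FiniteDimensional ℂ V] in
/-- Coordinates of a real-coefficient linear form: `‖Σ_{p∈S} c_p • G_p‖² = Σ_j ((Σ_p c_p·re⟪e_j, G_p⟫)² + (Σ_p c_p·im⟪e_j, G_p⟫)²)`. [folklore] -/
private theorem norm_sq_linform {n : Type*} [Fintype n] (e : OrthonormalBasis n ℂ V) (S : Finset π) (cf : π → ℝ) (G : π → V) :
    ‖∑ p ∈ S, ((cf p : ℝ) : ℂ) • G p‖ ^ 2 =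
      ∑ j, ((∑ p ∈ S, cf p * (⟪e j, G p⟫_ℂ).re) ^ 2 + (∑ p ∈ S, cf p * (⟪e j, G p⟫_ℂ).im) ^ 2) := by
  rw [norm_sq_eq_sum_re_sq_add_im_sq e]
  refine Finset.sum_congr rfl fun j _ => ?_
  have hV : ⟪e j, ∑ p ∈ S, ((cf p : ℝ) : ℂ) • G p⟫_ℂ = ∑ p ∈ S, ((cf p : ℝ) : ℂ) * ⟪e j, G p⟫_ℂ := by
    rw [inner_sum]
    exact Finset.sum_congr rfl fun p _ => inner_smul_right _ _ _
  rw [hV, Complex.re_sum, Complex.im_sum]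
  simp only [Complex.re_ofReal_mul, Complex.im_ofReal_mul]

/-- **D4 with two families of linear forms** (the shape of [B6] (2.128): curl terms AND `Q₁` terms). [cite: Balaban1984PropagatorsII, Lemma 2.4 (2.128) p.245] [folklore] -/
theorem quadIneq_transfer₂ {τ₁ π₁ τ₂ π₂ : Type*} (E : Finset ι) (Z : Set ι) (κ : ℝ)
    (T₁ : Finset τ₁) (w₁ : τ₁ → ℝ) (S₁ : τ₁ → Finset π₁) (cf₁ : τ₁ → π₁ → ℝ) (g₁ : τ₁ → π₁ → ι)
    (T₂ : Finset τ₂) (w₂ : τ₂ → ℝ) (S₂ : τ₂ → Finset π₂) (cf₂ : τ₂ → π₂ → ℝ) (g₂ : τ₂ → π₂ → ι)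
    (hreal : ∀ B : ι → ℝ, (∀ b ∈ Z, B b = 0) →
      κ * ∑ b ∈ E, B b ^ 2 ≤ ∑ t ∈ T₁, w₁ t * (∑ p ∈ S₁ t, cf₁ t p * B (g₁ t p)) ^ 2
        + ∑ t ∈ T₂, w₂ t * (∑ p ∈ S₂ t, cf₂ t p * B (g₂ t p)) ^ 2)
    (F : ι → V) (hF : ∀ b ∈ Z, F b = 0) :
    κ * ∑ b ∈ E, ‖F b‖ ^ 2 ≤ ∑ t ∈ T₁, w₁ t * ‖∑ p ∈ S₁ t, ((cf₁ t p : ℝ) : ℂ) • F (g₁ t p)‖ ^ 2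
      + ∑ t ∈ T₂, w₂ t * ‖∑ p ∈ S₂ t, ((cf₂ t p : ℝ) : ℂ) • F (g₂ t p)‖ ^ 2 := by
  classical
  set e := stdOrthonormalBasis ℂ V
  have hre := fun j => hreal (fun b => (⟪e j, F b⟫_ℂ).re) (fun b hb => by simp [hF b hb])
  have him := fun j => hreal (fun b => (⟪e j, F b⟫_ℂ).im) (fun b hb => by simp [hF b hb])
  calc κ * ∑ b ∈ E, ‖F b‖ ^ 2
      = ∑ j, (κ * ∑ b ∈ E, (⟪e j, F b⟫_ℂ).re ^ 2 + κ * ∑ b ∈ E, (⟪e j, F b⟫_ℂ).im ^ 2) := by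
        simp_rw [norm_sq_eq_sum_re_sq_add_im_sq e]
        rw [Finset.sum_comm, Finset.mul_sum]
        simp only [Finset.sum_add_distrib, mul_add]
    _ ≤ ∑ j, (∑ t ∈ T₁, w₁ t * ((∑ p ∈ S₁ t, cf₁ t p * (⟪e j, F (g₁ t p)⟫_ℂ).re) ^ 2
              + (∑ p ∈ S₁ t, cf₁ t p * (⟪e j, F (g₁ t p)⟫_ℂ).im) ^ 2)
            + ∑ t ∈ T₂, w₂ t * ((∑ p ∈ S₂ t, cf₂ t p * (⟪e j, F (g₂ t p)⟫_ℂ).re) ^ 2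
              + (∑ p ∈ S₂ t, cf₂ t p * (⟪e j, F (g₂ t p)⟫_ℂ).im) ^ 2)) :=
        Finset.sum_le_sum fun j _ =>
          (add_le_add (hre j) (him j)).trans_eq (by simp only [Finset.sum_add_distrib, mul_add]; ring)
    _ = ∑ t ∈ T₁, w₁ t * ‖∑ p ∈ S₁ t, ((cf₁ t p : ℝ) : ℂ) • F (g₁ t p)‖ ^ 2
          + ∑ t ∈ T₂, w₂ t * ‖∑ p ∈ S₂ t, ((cf₂ t p : ℝ) : ℂ) • F (g₂ t p)‖ ^ 2 := by
        simp only [norm_sq_linform e, Finset.mul_sum]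
        rw [Finset.sum_add_distrib]
        congr 1 <;> exact Finset.sum_comm

end Transfer

end Literature.MathematicalPhysics.QuantumFieldTheory.Balaban1983to89.NodeOFlatTransfer

end
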